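import Mathlib
import HarnessLib

/-!
# Dedekind–Artin independence of additive characters over any domain, and the characters
# `χ_ξ(ε) = ω^{⟨ξ,ε⟩}` of `(ℤ/3)^k` with values in a field containing a primitive cube root of unity

**Sources.** S. Lang, *Algebra* (3rd ed.), Ch. VI §4, Theorem 4.1 (Artin: distinct characters of a
monoid into a field are linearly independent) [Lang2002]; D. A. Mix Barrington, H. Straubing,
D. Thérien, *Non-uniform automata over groups*, Inform. and Comput. 89 (1990), §6 pp. 122–123 (the
functions `P_w(x) = w₁^{log x₁}⋯wₙ^{log xₙ}`, i.e. the characters of `(F*)ⁿ ≅ (ℤ/k)ⁿ`, form a basis of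
the functions `(F*)ⁿ → F`) [BarringtonStraubingTherien1990].  Mathlib proves Dedekind's theorem
for MULTIPLICATIVE characters over a domain (`linearIndependent_monoidHom`) and for additive
characters only over `ℝ`/`ℂ` (`AddChar.linearIndependent`, `[RCLike R]`); the additive/domain form
and the `(ℤ/3)^k` dictionary below are the transport (all proved, no named facts).

* `addChar_linearIndependent` — for any additive monoid `A` and any commutative domain `L`, the
  family `(ψ : A → L)_{ψ ∈ AddChar A L}` is linearly independent over `L`.
* `dotHom ξ` (`ε ↦ Σ ξ_i ε_i`), `dotChar ω h3 ξ : AddChar (Fin k → ZMod 3) F` (`= ω^{(Σ ξ_i ε_i).val}`,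
  `dotChar_apply`) for `ω³ = 1`; `dotChar_injective` (`ω ≠ 1`); `linearIndependent_dotChar`;
  `eq_zero_of_sum_dotChar_eq_zero` — coefficient reading: `Σ_ξ c_ξ ω^{⟨ξ,ε⟩} = 0` for all `ε` forces
  `c = 0` (finite-sum form over all of `(ℤ/3)^k`, and over any finset of exponent vectors).

Consumer: cell qa-qnc0, ROUND-34 §3.3 / P-38c `StarPartner` (characters of the creation-shift group
`𝔽₃^H` read in a field of characteristic `2` containing `ω`, `ω² + ω + 1 = 0`; there
`AddChar.linearIndependent` does not apply because `F` is not `ℝ`/`ℂ`).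
-/

namespace Literature.GroupTheory.Abelian.AddCharIndependence

open Finset

/-! ### 1. Dedekind–Artin for additive characters over a domain -/

/-- **Dedekind–Artin independence of additive characters**: distinct additive characters of an
additive monoid with values in a commutative domain are linearly independent.
[cite: Lang2002, Ch. VI §4 Thm 4.1 (Artin); additive transport of Mathlib's `linearIndependent_monoidHom`] -/
theorem addChar_linearIndependent (A L : Type*) [AddMonoid A] [CommRing L] [IsDomain L] :
    LinearIndependent L (fun ψ : AddChar A L => (ψ : A → L)) := by
  classical
  have h := (linearIndependent_monoidHom (Multiplicative A) L).comp _
    (AddChar.toMonoidHomEquiv (A := A) (M := L)).injective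
  rw [linearIndependent_iff'] at h ⊢
  intro s g hg ψ hψ
  refine h s g ?_ ψ hψ
  funext a
  have := congrFun hg (Multiplicative.toAdd a)
  simpa [Finset.sum_apply, Pi.smul_apply] using this

/-- Coefficient reading, finset form: if `Σ_{ψ ∈ s} g_ψ · ψ ≡ 0` then every `g_ψ = 0`.
[cite: Lang2002, Ch. VI §4 Thm 4.1] -/
theorem eq_zero_of_sum_addChar_eq_zero {A L : Type*} [AddMonoid A] [CommRing L] [IsDomain L]
    (s : Finset (AddChar A L)) (g : AddChar A L → L) (h : ∀ a : A, ∑ ψ ∈ s, g ψ * ψ a = 0) :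
    ∀ ψ ∈ s, g ψ = 0 := by
  have hli := addChar_linearIndependent A L
  rw [linearIndependent_iff'] at hli
  refine hli s g ?_
  funext a
  simpa [Finset.sum_apply, Pi.smul_apply] using h a

/-! ### 2. The characters `χ_ξ(ε) = ω^{⟨ξ,ε⟩}` of `(ℤ/3)^k` -/

section Cube

variable {F : Type*} [Field F] {k : ℕ}

/-- The linear functional `ε ↦ ⟨ξ, ε⟩ = Σ_i ξ_i ε_i` on `(ℤ/3)^k` as an additive monoid hom.
[cite: BarringtonStraubingTherien1990, §6 (the exponents in P_w); bookkeeping supplied here] -/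
def dotHom (ξ : Fin k → ZMod 3) : (Fin k → ZMod 3) →+ ZMod 3 where
  toFun ε := ∑ i, ξ i * ε i
  map_zero' := by simp
  map_add' ε ε' := by simp [mul_add, sum_add_distrib]

/-- Unfolding `dotHom`. [cite: BarringtonStraubingTherien1990, §6] -/
@[simp] theorem dotHom_apply (ξ ε : Fin k → ZMod 3) : dotHom ξ ε = ∑ i, ξ i * ε i := rfl

/-- **The character `χ_ξ = ω^{⟨ξ,·⟩}` of `(ℤ/3)^k`** with values in `F`, for a cube root of unity `ω`.
[cite: BarringtonStraubingTherien1990, §6 (P_w(x) = w₁^{log x₁}⋯wₙ^{log xₙ})] -/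
def dotChar (ω : F) (h3 : ω ^ 3 = 1) (ξ : Fin k → ZMod 3) : AddChar (Fin k → ZMod 3) F :=
  (AddChar.zmodChar 3 h3).compAddMonoidHom (dotHom ξ)

/-- `χ_ξ(ε) = ω^{(Σ ξ_i ε_i).val}`. [cite: BarringtonStraubingTherien1990, §6] -/
theorem dotChar_apply (ω : F) (h3 : ω ^ 3 = 1) (ξ ε : Fin k → ZMod 3) :
    dotChar ω h3 ξ ε = ω ^ (∑ i, ξ i * ε i).val := by
  simp [dotChar, AddChar.zmodChar_apply]

/-- `χ_ξ · χ_{ξ'} = χ_{ξ+ξ'}` (pointwise). [cite: BarringtonStraubingTherien1990, §6 (Q_v · Q_w = Q_{vw})] -/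
theorem dotChar_add (ω : F) (h3 : ω ^ 3 = 1) (ξ ξ' ε : Fin k → ZMod 3) :
    dotChar ω h3 (ξ + ξ') ε = dotChar ω h3 ξ ε * dotChar ω h3 ξ' ε := by
  have : dotHom (ξ + ξ') ε = dotHom ξ ε + dotHom ξ' ε := by
    simp [dotHom, add_mul, sum_add_distrib]
  simp only [dotChar, AddChar.compAddMonoidHom_apply, this, AddChar.map_add_eq_mul]

/-- A cube root of unity `ω ≠ 1` is primitive: `ω^{a.val} = 1 ↔ a = 0` in `ℤ/3`. [folklore] -/
private theorem pow_val_eq_one_iff {ω : F} (h3 : ω ^ 3 = 1) (hω1 : ω ≠ 1) (a : ZMod 3) :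
    ω ^ a.val = 1 ↔ a = 0 := by
  constructor
  · intro h
    by_contra ha
    have hval : a.val = 1 ∨ a.val = 2 := by
      have := a.val_lt; have h0 : a.val ≠ 0 := fun h0 => ha ((ZMod.val_eq_zero a).1 h0); omega
    rcases hval with hv | hv
    · rw [hv, pow_one] at h; exact hω1 h
    · rw [hv] at h
      -- ω = ω³ / ω² = 1
      have hω0 : ω ≠ 0 := fun h0 => by rw [h0] at h3; norm_num at h3
      apply hω1
      have : ω ^ 3 = ω ^ 2 * ω := by ring
      rw [this, h, one_mul] at h3
      exact h3
  · intro h; rw [h]; simp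

/-- **`ξ ↦ χ_ξ` is injective** when `ω ≠ 1` (evaluate at the coordinate vectors).
[cite: BarringtonStraubingTherien1990, §6 (distinct w give distinct P_w); supplied here] -/
theorem dotChar_injective {ω : F} (h3 : ω ^ 3 = 1) (hω1 : ω ≠ 1) :
    Function.Injective (dotChar (k := k) ω h3) := by
  intro ξ ξ' h
  funext i
  have hi := congrArg (fun χ : AddChar (Fin k → ZMod 3) F => χ (Pi.single i 1)) h
  simp only [dotChar_apply] at hi
  have hs : ∀ ζ : Fin k → ZMod 3, ∑ j, ζ j * (Pi.single i (1 : ZMod 3) : Fin k → ZMod 3) j = ζ i := by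
    intro ζ
    rw [Finset.sum_eq_single i]
    · simp
    · intro j _ hj; simp [hj]
    · intro h; exact absurd (mem_univ i) h
  rw [hs ξ, hs ξ'] at hi
  -- ω^{ξ_i} = ω^{ξ'_i} ⇒ ω^{(ξ_i − ξ'_i).val} = 1
  have hω0 : ω ≠ 0 := fun h0 => by rw [h0] at h3; norm_num at h3
  have key : ω ^ (ξ i - ξ' i).val = 1 := by
    have e := (dotChar_add ω h3 (fun _ => ξ i - ξ' i) (fun _ => ξ' i) (Pi.single i 1))
    simp only [dotChar_apply, hs, Pi.add_apply, sub_add_cancel] at e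
    -- e : ω^{ξ i .val} = ω^{(ξ i - ξ' i).val} * ω^{ξ' i .val}
    rw [hi] at e
    have hne : ω ^ (ξ' i).val ≠ 0 := pow_ne_zero _ hω0
    calc ω ^ (ξ i - ξ' i).val = ω ^ (ξ i - ξ' i).val * ω ^ (ξ' i).val / ω ^ (ξ' i).val := by
          rw [mul_div_assoc, div_self hne, mul_one]
      _ = 1 := by rw [← e, div_self hne]
  exact sub_eq_zero.1 ((pow_val_eq_one_iff h3 hω1 _).1 key)

/-- **The `3^k` characters `χ_ξ` are linearly independent over `F`** (Dedekind–Artin, any field `F`,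
in particular of characteristic `2`). [cite: Lang2002, Ch. VI §4 Thm 4.1; BarringtonStraubingTherien1990, §6] -/
theorem linearIndependent_dotChar {ω : F} (h3 : ω ^ 3 = 1) (hω1 : ω ≠ 1) :
    LinearIndependent F (fun ξ : Fin k → ZMod 3 => (dotChar ω h3 ξ : (Fin k → ZMod 3) → F)) :=
  (addChar_linearIndependent (Fin k → ZMod 3) F).comp _ (dotChar_injective h3 hω1)

/-- **Coefficient reading on `(ℤ/3)^k`**: if `Σ_ξ c_ξ ω^{⟨ξ,ε⟩} = 0` for every `ε` then `c = 0`.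
[cite: Lang2002, Ch. VI §4 Thm 4.1; BarringtonStraubingTherien1990, §6 (uniqueness of the P_w expansion)] -/
theorem eq_zero_of_sum_dotChar_eq_zero {ω : F} (h3 : ω ^ 3 = 1) (hω1 : ω ≠ 1)
    (c : (Fin k → ZMod 3) → F) (h : ∀ ε : Fin k → ZMod 3, ∑ ξ, c ξ * ω ^ (∑ i, ξ i * ε i).val = 0) :
    c = 0 := by
  have hli := linearIndependent_dotChar (k := k) h3 hω1
  rw [Fintype.linearIndependent_iff] at hli
  funext ξ
  refine hli c ?_ ξ
  funext ε
  have := h ε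
  simp only [Finset.sum_apply, Pi.smul_apply, smul_eq_mul, dotChar_apply, Pi.zero_apply]
  exact this

/-- Finset form: if `Σ_{ξ ∈ s} c_ξ ω^{⟨ξ,ε⟩} = 0` for every `ε` then `c_ξ = 0` on `s`.
[cite: Lang2002, Ch. VI §4 Thm 4.1; BarringtonStraubingTherien1990, §6] -/
theorem eq_zero_of_sum_dotChar_eq_zero' {ω : F} (h3 : ω ^ 3 = 1) (hω1 : ω ≠ 1)
    (s : Finset (Fin k → ZMod 3)) (c : (Fin k → ZMod 3) → F)
    (h : ∀ ε : Fin k → ZMod 3, ∑ ξ ∈ s, c ξ * ω ^ (∑ i, ξ i * ε i).val = 0) :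
    ∀ ξ ∈ s, c ξ = 0 := by
  classical
  have hz := eq_zero_of_sum_dotChar_eq_zero h3 hω1 (fun ξ => if ξ ∈ s then c ξ else 0) fun ε => by
    rw [← Finset.sum_filter_add_sum_filter_not univ (fun ξ => ξ ∈ s)]
    have h1 : univ.filter (fun ξ : Fin k → ZMod 3 => ξ ∈ s) = s := by ext ξ; simp
    rw [h1, Finset.sum_eq_zero (s := univ.filter fun ξ => ξ ∉ s) fun ξ hξ => by
      rw [if_neg (mem_filter.1 hξ).2, zero_mul], add_zero]
    exact Eq.trans (sum_congr rfl fun ξ hξ => by rw [if_pos hξ]) (h ε)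
  intro ξ hξ
  have := congrFun hz ξ
  simpa [hξ] using this

/-- In characteristic `2`, a root of `X² + X + 1` is a cube root of unity `≠ 1` (the cell's setting).
[cite: BarringtonStraubingTherien1990, §6; supplied here] -/
theorem cubeRoot_of_charTwo [CharP F 2] {ω : F} (hω : ω ^ 2 + ω + 1 = 0) : ω ^ 3 = 1 ∧ ω ≠ 1 := by
  have h2 : (2 : F) = 0 := CharTwo.two_eq_zero
  refine ⟨by linear_combination (ω + 1) * hω - (ω ^ 2 + ω + 1) * h2, fun h1 => ?_⟩
  rw [h1] at hω
  have : (1 : F) = 0 := by linear_combination hω - h2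
  exact one_ne_zero this

end Cube

end Literature.GroupTheory.Abelian.AddCharIndependence
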